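import Summits.QuantumFields.GaugeBoot.TiltedBox
import Literature.MathematicalPhysics.QuantumFieldTheory.LatticeGaugeProofs
import HarnessLib

/-!
# Infinite-volume limit points of the 45°-tilted periodic boxes (gauge-boot, L3 / R9 twin, part 1: definitions)

HONEST FRAMING (cell `pub-gaugeboot`, page 1 of every file): the venture produces certified bounds
on lattice expectations at stated coupling, gauge group, dimension and torus size; NOT a mass gap,
NOT a continuum limit, NOT a string tension; NOT Yang–Mills-summit-bearing (barriers
`FixedCouplingUltralocality`, `PerturbativeInvisibility`). This module only DEFINES a class of
infinite-volume states and proves it non-empty; it discharges nothing else.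

## Content

The tree's infinite-volume limit points `infiniteVolumeLimitPoints ρ β` (`LatticeGaugeDLR.lean`)
are the weak limits of the Wilson states of the CUBIC tori `(ℤ/L)^d`; they carry site and link
reflection positivity along every axis, but whether they carry DIAGONAL reflection positivity is
open (`TorusLimitPointsDiagonalRP`, `ClassB.lean`; the cubic tori themselves violate it,
`DiagonalRPTorusNegative.lean`). The 45°-tilted periodic boxes `ℤ^d/Γ(M_u, M_v, L)` of
Fröhlich–Israel–Lieb–Simon (`TiltedBox.lean`) DO carry diagonal reflection positivity in the
`(i, j)`-plane (`tiltedBox_diagonalRP`), site and link reflection positivity along the axes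
`k ∉ {i, j}` (`tiltedBox_siteRP`, `tiltedBox_linkRP`), translation invariance and the one-link
Haar-shift identity; this file starts the transfer of these properties to THEIR infinite-volume
limit points, a second, unconditionally non-empty class of infinite-volume Wilson states
("tilted limit points"), by setting up:

* `tiltedEdge`, `tiltedLift` — the `Γ`-periodic lift of a box configuration to a configuration of
  `ℤ^d` (`(tiltedLift U)(x, k) = U([x], k)`), measurable and continuous;
* `tiltedState ρ i j M_u M_v L β` — the box Wilson state `gibbs ρ (tiltedUnit …) β` pushed forward
  to `LGConfig d G` along the lift (a probability measure; `integral_tiltedState`);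
* `IsTiltedBoxLimitAlong d i j ρ β M Q μ` — `μ` is a probability measure and the states of the
  SQUARE boxes `ℤ^d/Γ(M_k + 2, M_k + 2, 2(Q_k + 2))` converge to `μ` on bounded continuous cylinder
  observables (square side parameter `≥ 2`, even transverse period `≥ 4`: exactly the hypotheses of
  the box theorems `tiltedBox_diagonalRP` / `tiltedBox_siteRP` / `tiltedBox_linkRP` and of the axis
  flips of the square box, so that every box of the family carries all of them);
* `tiltedBoxLimitPoints d i j ρ β` — the set of such limits along families with `M_k → ∞`,
  `Q_k → ∞`;
* **`tiltedBoxLimitPoints_nonempty`** — it is non-empty for every compact second countable `G`,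
  continuous `ρ`, real `β` (Prokhorov / Riesz–Markov compactness of the probability measures on
  the compact metrisable `G^{edges(ℤ^d)}`, as for the cubic tori in
  `LatticeGaugeDLRLimitPointsProofs.lean`);
* two generic limit tools used by the sequel files: `IsTiltedBoxLimitAlong.integral_nonneg_of_eventually`
  (a bounded continuous complex cylinder observable whose box expectations are eventually `≥ 0` in
  the order of `ℂ` has `∫ H dμ ≥ 0`) and `IsTiltedBoxLimitAlong.map_eq_of_eventually` (a measurable
  continuous map of configurations preserving cylinders, under which the box expectations are
  eventually invariant, preserves `μ`).

No property of the limit points beyond non-emptiness is claimed here (sequel files: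
`TiltedBoxLimitGeometry`, `…Invariance`, `…DiagonalRP`, `…AxisRP`, `…HaarShift`, `…Class`).

References: J. Fröhlich, R. Israel, E. H. Lieb, B. Simon, J. Stat. Phys. 22 (1980) 297, §3;
E. Seiler, LNP 159 (1982) Ch. 2; S. Friedli, Y. Velenik, Statistical Mechanics of Lattice Systems
(2017) Ch. 10 (reflection positivity of torus states and their thermodynamic limits).
-/

noncomputable section

open MeasureTheory Filter Topology
open scoped ComplexOrder ComplexConjugate
open Literature.Probability.LatticeModels (Site)
open Literature.MathematicalPhysics.QuantumLattice
open Literature.MathematicalPhysics.QuantumFieldTheory (measure_eq_of_integral_cylinder_eq)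

namespace Summit.QuantumFields.GaugeBoot

namespace TiltedRP

/-! ## `NeZero` bookkeeping for the box family `ℤ^d/Γ(M + 2, M + 2, 2(Q + 2))` -/

/-- `n + 2 ≠ 0` (side parameters of the box family). -/
instance neZero_add_two (n : ℕ) : NeZero (n + 2) := ⟨by omega⟩

/-- `2(n + 2) ≠ 0` (transverse periods of the box family). -/
instance neZero_two_mul_add_two (n : ℕ) : NeZero (2 * (n + 2)) := ⟨by omega⟩

/-! ## The periodic lift of box configurations to `ℤ^d` -/

section Lift

variable (d : ℕ) (i j : Fin d) (Mu Mv L : ℕ) {G : Type*}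

/-- The link of the tilted box `ℤ^d/Γ` below the edge `(x, k)` of `ℤ^d`: `([x], k)`. -/
def tiltedEdge (e : ZdEdge d) : Link (TiltedSite d i j Mu Mv L) d :=
  ((e.1 : TiltedSite d i j Mu Mv L), e.2)

/-- **The `Γ`-periodic lift** of a box configuration to a gauge configuration of `ℤ^d`:
`(tiltedLift U)(x, k) = U([x], k)`. -/
def tiltedLift (U : Config (TiltedSite d i j Mu Mv L) d G) : LGConfig d G :=
  fun e => U (tiltedEdge d i j Mu Mv L e)

/-- `tiltedEdge` evaluated. -/
@[simp] theorem tiltedEdge_apply (e : ZdEdge d) :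
    tiltedEdge d i j Mu Mv L e = ((e.1 : TiltedSite d i j Mu Mv L), e.2) := rfl

/-- `tiltedLift` evaluated. -/
@[simp] theorem tiltedLift_apply (U : Config (TiltedSite d i j Mu Mv L) d G) (e : ZdEdge d) :
    tiltedLift d i j Mu Mv L U e = U ((e.1 : TiltedSite d i j Mu Mv L), e.2) := rfl

/-- The lift is measurable (each coordinate is an evaluation). -/
theorem measurable_tiltedLift [MeasurableSpace G] :
    Measurable (tiltedLift d i j Mu Mv L (G := G)) :=
  measurable_pi_lambda _ fun _ => measurable_pi_apply _

/-- The lift is continuous. -/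
theorem continuous_tiltedLift [TopologicalSpace G] :
    Continuous (tiltedLift d i j Mu Mv L (G := G)) :=
  continuous_pi fun _ => continuous_apply _

/-- A cylinder observable with support `S` read through the lift depends only on the box links
below `S`. -/
theorem dependsOn_comp_tiltedLift {α : Type*} {F : LGConfig d G → α} {S : Finset (ZdEdge d)}
    (hF : IsCylinder F S) :
    DependsOn (fun U => F (tiltedLift d i j Mu Mv L U))
      (tiltedEdge d i j Mu Mv L '' (S : Set (ZdEdge d))) := by
  intro U V hUV
  refine hF fun e he => ?_
  simp only [tiltedLift_apply]
  exact hUV _ ⟨e, he, rfl⟩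

end Lift

/-! ## The box Wilson state on `ℤ^d` configurations -/

section State

variable {d : ℕ} (i j : Fin d) (Mu Mv L : ℕ) {N : ℕ} [NeZero Mu] [NeZero Mv] [NeZero L]
variable {G : Type*} [Group G] [TopologicalSpace G] [IsTopologicalGroup G] [CompactSpace G]
  [MeasurableSpace G] [BorelSpace G]
variable (ρ : G →* Matrix (Fin N) (Fin N) ℂ)

/-- **The Wilson state of the tilted box transported to `ℤ^d`**: the push-forward of
`gibbs ρ (tiltedUnit …) β` along the periodic lift. -/
def tiltedState (β : ℝ) : Measure (LGConfig d G) :=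
  (gibbs ρ (tiltedUnit d i j Mu Mv L) β).map (tiltedLift d i j Mu Mv L)

variable [SecondCountableTopology G]

/-- The transported state is a probability measure (continuous `ρ`). -/
theorem isProbabilityMeasure_tiltedState (hρ : Continuous ρ) (β : ℝ) :
    IsProbabilityMeasure (tiltedState i j Mu Mv L ρ β) := by
  haveI := isProbabilityMeasure_gibbs (A := TiltedSite d i j Mu Mv L) (G := G) ρ hρ
    (tiltedUnit d i j Mu Mv L) β
  exact Measure.isProbabilityMeasure_map (measurable_tiltedLift d i j Mu Mv L).aemeasurable

omit [SecondCountableTopology G] in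
/-- **Integration against the transported state**: `∫ F d(tiltedState) = ∫ F(tiltedLift U) dμ_β(U)`
for measurable `F`. -/
theorem integral_tiltedState (β : ℝ) {E : Type*} [NormedAddCommGroup E] [NormedSpace ℝ E]
    [MeasurableSpace E] [BorelSpace E] [SecondCountableTopology E] {F : LGConfig d G → E}
    (hF : Measurable F) :
    ∫ U, F U ∂(tiltedState i j Mu Mv L ρ β) =
      ∫ U, F (tiltedLift d i j Mu Mv L U) ∂(gibbs ρ (tiltedUnit d i j Mu Mv L) β) := by
  rw [tiltedState, integral_map (measurable_tiltedLift d i j Mu Mv L).aemeasurable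
    hF.stronglyMeasurable.aestronglyMeasurable]

end State

/-! ## Limits along families of square boxes with even transverse period -/

section Limits

variable (d : ℕ) (i j : Fin d) {N : ℕ}
variable {G : Type*} [Group G] [TopologicalSpace G] [IsTopologicalGroup G] [CompactSpace G]
  [MeasurableSpace G] [BorelSpace G]
variable (ρ : G →* Matrix (Fin N) (Fin N) ℂ)

/-- **`μ` is the infinite-volume limit of the tilted-box Wilson states along the family
`k ↦ ℤ^d/Γ(M_k + 2, M_k + 2, 2(Q_k + 2))`** (square boxes of side parameter `M_k + 2 ≥ 2` in the
`(i, j)`-plane, even period `2(Q_k + 2) ≥ 4` along the other axes): `μ` is a probability measure on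
`LGConfig d G` and `∫ F(tiltedLift U) dμ_{k,β}(U) → ∫ F dμ` for every bounded continuous cylinder
observable `F`. [shape] A parametric definition of a proposition — NOT a fact. [folklore] -/
def IsTiltedBoxLimitAlong (β : ℝ) (M Q : ℕ → ℕ) (μ : Measure (LGConfig d G)) : Prop :=
  IsProbabilityMeasure μ ∧
    ∀ (F : LGConfig d G → ℝ) (S : Finset (ZdEdge d)), IsCylinder F S → Continuous F →
      (∃ C, ∀ U, |F U| ≤ C) →
        Tendsto (fun k : ℕ => ∫ U, F (tiltedLift d i j (M k + 2) (M k + 2) (2 * (Q k + 2)) U)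
          ∂(gibbs ρ (tiltedUnit d i j (M k + 2) (M k + 2) (2 * (Q k + 2))) β)) atTop
          (𝓝 (∫ U, F U ∂μ))

/-- **The tilted limit points at coupling `β`**: probability measures on `LGConfig d G` arising as
limits of the Wilson states of the square 45°-tilted boxes `ℤ^d/Γ(M_k + 2, M_k + 2, 2(Q_k + 2))`
along some family with `M_k → ∞` and `Q_k → ∞`. [shape] A definition of a set of measures — NOT a
fact. [folklore] -/
def tiltedBoxLimitPoints (β : ℝ) : Set (Measure (LGConfig d G)) :=
  {μ | ∃ M Q : ℕ → ℕ, Tendsto M atTop atTop ∧ Tendsto Q atTop atTop ∧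
    IsTiltedBoxLimitAlong d i j ρ β M Q μ}

variable {d i j ρ}

/-- A tilted limit point is a probability measure. -/
theorem isProbabilityMeasure_of_mem_tiltedBoxLimitPoints {β : ℝ} {μ : Measure (LGConfig d G)}
    (hμ : μ ∈ tiltedBoxLimitPoints d i j ρ β) : IsProbabilityMeasure μ := by
  obtain ⟨_, _, _, _, h, _⟩ := hμ
  exact h

variable [SecondCountableTopology G]

/-- **Tilted limit points exist** (`G` compact Hausdorff second countable, `ρ` continuous, every
real `β`): the transported states of the boxes `ℤ^d/Γ(k + 2, k + 2, 2(k + 2))` have a subsequence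
converging on all bounded continuous functions, by compactness and metrisability of the space of
probability measures on the compact metrisable `G^{edges(ℤ^d)}` (Riesz–Markov / Prokhorov). -/
theorem tiltedBoxLimitPoints_nonempty [T2Space G] (hρ : Continuous ρ) (β : ℝ) :
    (tiltedBoxLimitPoints d i j ρ β).Nonempty := by
  haveI := fun k : ℕ =>
    isProbabilityMeasure_tiltedState (d := d) i j (k + 2) (k + 2) (2 * (k + 2)) ρ hρ β
  let P : ℕ → ProbabilityMeasure (LGConfig d G) := fun k =>
    ⟨tiltedState i j (k + 2) (k + 2) (2 * (k + 2)) ρ β, inferInstance⟩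
  obtain ⟨μ, -, φ, hφ, hlim⟩ :=
    (isCompact_univ (X := ProbabilityMeasure (LGConfig d G))).tendsto_subseq
      fun n => Set.mem_univ (P n)
  refine ⟨(μ : Measure (LGConfig d G)), φ, φ, hφ.tendsto_atTop, hφ.tendsto_atTop, inferInstance,
    fun F S _ hFc hFb => ?_⟩
  obtain ⟨C, hC⟩ := hFb
  let Fb : BoundedContinuousFunction (LGConfig d G) ℝ :=
    BoundedContinuousFunction.ofNormedAddCommGroup F hFc C
      (fun U => by simpa [Real.norm_eq_abs] using hC U)
  have hE : (fun k : ℕ => ∫ U, F (tiltedLift d i j (φ k + 2) (φ k + 2) (2 * (φ k + 2)) U)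
      ∂(gibbs ρ (tiltedUnit d i j (φ k + 2) (φ k + 2) (2 * (φ k + 2))) β)) =
      fun k => ∫ U, Fb U ∂(P (φ k) : Measure (LGConfig d G)) :=
    funext fun k => (integral_tiltedState i j (φ k + 2) (φ k + 2) (2 * (φ k + 2)) ρ β
      hFc.measurable).symm
  have key : Tendsto (fun k : ℕ => ∫ U, Fb U ∂(P (φ k) : Measure (LGConfig d G))) atTop
      (𝓝 (∫ U, Fb U ∂(μ : Measure (LGConfig d G)))) :=
    (ProbabilityMeasure.tendsto_iff_forall_integral_tendsto.1 hlim) Fb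
  rw [hE]
  exact key

/-! ## Generic limit tools -/

namespace IsTiltedBoxLimitAlong

variable {β : ℝ} {M Q : ℕ → ℕ} {μ : Measure (LGConfig d G)}

omit [SecondCountableTopology G] in
/-- The defining convergence, restated. -/
theorem tendsto_integral (h : IsTiltedBoxLimitAlong d i j ρ β M Q μ) {F : LGConfig d G → ℝ}
    {S : Finset (ZdEdge d)} (hFS : IsCylinder F S) (hFc : Continuous F) {C : ℝ}
    (hC : ∀ U, |F U| ≤ C) :
    Tendsto (fun k : ℕ => ∫ U, F (tiltedLift d i j (M k + 2) (M k + 2) (2 * (Q k + 2)) U)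
      ∂(gibbs ρ (tiltedUnit d i j (M k + 2) (M k + 2) (2 * (Q k + 2))) β)) atTop
      (𝓝 (∫ U, F U ∂μ)) :=
  h.2 F S hFS hFc ⟨C, hC⟩

/-- **Non-negativity passes to the limit** (complex observables, order of `ℂ`): if a bounded
continuous complex cylinder observable `H` has box expectations `∫ H(tiltedLift U) dμ_{k,β}`
eventually real and non-negative, then `0 ≤ ∫ H dμ`. -/
theorem integral_nonneg_of_eventually (hρ : Continuous ρ) (h : IsTiltedBoxLimitAlong d i j ρ β M Q μ)
    {H : LGConfig d G → ℂ} {T : Finset (ZdEdge d)} (hHT : IsCylinder H T) (hHc : Continuous H)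
    {C : ℝ} (hC : ∀ U, ‖H U‖ ≤ C)
    (hev : ∀ᶠ k in atTop, 0 ≤ ∫ U, H (tiltedLift d i j (M k + 2) (M k + 2) (2 * (Q k + 2)) U)
      ∂(gibbs ρ (tiltedUnit d i j (M k + 2) (M k + 2) (2 * (Q k + 2))) β)) :
    0 ≤ ∫ U, H U ∂μ := by
  haveI := h.1
  have hre := h.tendsto_integral (F := fun U => (H U).re) (S := T)
    (fun U V hUV => by simp only [hHT hUV]) (Complex.continuous_re.comp hHc)
    (C := C) fun U => (Complex.abs_re_le_norm _).trans (hC U)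
  have him := h.tendsto_integral (F := fun U => (H U).im) (S := T)
    (fun U V hUV => by simp only [hHT hUV]) (Complex.continuous_im.comp hHc)
    (C := C) fun U => (Complex.abs_im_le_norm _).trans (hC U)
  -- real and imaginary parts of the box expectations
  have hev' : ∀ᶠ k in atTop,
      0 ≤ ∫ U, (H (tiltedLift d i j (M k + 2) (M k + 2) (2 * (Q k + 2)) U)).re
        ∂(gibbs ρ (tiltedUnit d i j (M k + 2) (M k + 2) (2 * (Q k + 2))) β) ∧
      ∫ U, (H (tiltedLift d i j (M k + 2) (M k + 2) (2 * (Q k + 2)) U)).im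
        ∂(gibbs ρ (tiltedUnit d i j (M k + 2) (M k + 2) (2 * (Q k + 2))) β) = 0 := by
    refine hev.mono fun k hk => ?_
    haveI := isProbabilityMeasure_gibbs (A := TiltedSite d i j (M k + 2) (M k + 2) (2 * (Q k + 2)))
      (G := G) ρ hρ (tiltedUnit d i j (M k + 2) (M k + 2) (2 * (Q k + 2))) β
    have hint : Integrable (fun U => H (tiltedLift d i j (M k + 2) (M k + 2) (2 * (Q k + 2)) U))
        (gibbs ρ (tiltedUnit d i j (M k + 2) (M k + 2) (2 * (Q k + 2))) β) :=
      Integrable.of_bound ((hHc.comp (continuous_tiltedLift _ _ _ _ _ _)).measurable.aestronglyMeasurable)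
        C (ae_of_all _ fun U => hC _)
    obtain ⟨h1, h2⟩ := Complex.nonneg_iff.1 hk
    have e1 := integral_re hint
    have e2 := integral_im hint
    simp only [RCLike.re_to_complex, RCLike.im_to_complex] at e1 e2
    exact ⟨e1 ▸ h1, (e2 ▸ h2).symm⟩
  have hint : Integrable H μ :=
    Integrable.of_bound hHc.measurable.aestronglyMeasurable C (ae_of_all _ fun U => hC _)
  have h1 : 0 ≤ ∫ U, (H U).re ∂μ := ge_of_tendsto hre (hev'.mono fun k hk => hk.1)
  have h2 : ∫ U, (H U).im ∂μ = 0 :=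
    tendsto_nhds_unique him (tendsto_const_nhds.congr' (hev'.mono fun k hk => hk.2.symm))
  have hre' : (∫ U, H U ∂μ).re = ∫ U, (H U).re ∂μ := by
    have e := integral_re hint
    simp only [RCLike.re_to_complex] at e
    exact e.symm
  have him' : (∫ U, H U ∂μ).im = ∫ U, (H U).im ∂μ := by
    have e := integral_im hint
    simp only [RCLike.im_to_complex] at e
    exact e.symm
  refine Complex.nonneg_iff.2 ⟨?_, ?_⟩
  · rw [hre']; exact h1
  · rw [him', h2]

omit [SecondCountableTopology G] in
/-- **Invariance passes to the limit**: a measurable continuous map `Ψ` of configurations which maps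
cylinder observables to cylinder observables, and under which the box expectations of every bounded
continuous cylinder observable are eventually invariant, preserves `μ`. -/
theorem map_eq_of_eventually [T2Space G] [SecondCountableTopology G]
    (h : IsTiltedBoxLimitAlong d i j ρ β M Q μ)
    {Ψ : LGConfig d G → LGConfig d G} (hΨm : Measurable Ψ) (hΨc : Continuous Ψ)
    (hcyl : ∀ (F : LGConfig d G → ℝ) (S : Finset (ZdEdge d)), IsCylinder F S →
      ∃ S' : Finset (ZdEdge d), IsCylinder (F ∘ Ψ) S')
    (hbox : ∀ (F : LGConfig d G → ℝ) (S : Finset (ZdEdge d)), IsCylinder F S → Continuous F →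
      (∃ C, ∀ U, |F U| ≤ C) → ∀ᶠ k in atTop,
        ∫ U, F (Ψ (tiltedLift d i j (M k + 2) (M k + 2) (2 * (Q k + 2)) U))
            ∂(gibbs ρ (tiltedUnit d i j (M k + 2) (M k + 2) (2 * (Q k + 2))) β) =
          ∫ U, F (tiltedLift d i j (M k + 2) (M k + 2) (2 * (Q k + 2)) U)
            ∂(gibbs ρ (tiltedUnit d i j (M k + 2) (M k + 2) (2 * (Q k + 2))) β)) :
    μ.map Ψ = μ := by
  haveI := h.1
  haveI : IsProbabilityMeasure (μ.map Ψ) := Measure.isProbabilityMeasure_map hΨm.aemeasurable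
  refine measure_eq_of_integral_cylinder_eq fun F S hFS hFc hFb => ?_
  obtain ⟨C, hC⟩ := hFb
  rw [integral_map hΨm.aemeasurable (hFc.stronglyMeasurable.aestronglyMeasurable)]
  obtain ⟨S', hS'⟩ := hcyl F S hFS
  have h1 := h.tendsto_integral (F := F ∘ Ψ) hS' (hFc.comp hΨc) (C := C) fun U => hC _
  have h2 := h.tendsto_integral hFS hFc hC
  simp only [Function.comp_apply] at h1
  exact tendsto_nhds_unique (h1.congr' (hbox F S hFS hFc ⟨C, hC⟩)) h2

end IsTiltedBoxLimitAlong

end Limits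

end TiltedRP

end Summit.QuantumFields.GaugeBoot
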